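import Summits.BirchSwinnertonDyer.BirchSwinnertonDyer.Theorems.PrintCFramBottomClassIndexLawFiveLeBorelUniserialLeaf
import Literature.NumberTheory.EllipticCurves.HeegnerPointsKolyvaginConjugation
import HarnessLib

/-!
# Route `PrintCFram`, crux C2 `BottomClassIndexLawFiveLe` (stmt-BirchSwinnertonDyer-20372), line
# `eisenstein-resource-bdp-line` (S2 `stub_kolyvaginUpper_borelCM_pairSum`, structure):
# **complex conjugation ANTI-commutes with `√−p`** — `c₀ · √−p = −√−p`, `μ ∘ c₀ = −c₀ ∘ μ` on
# `W(ℚ̄)`, and the lift `τ` of complex conjugation on `W(K̄)[n]` sends the `μ`-image of a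
# `ν`-eigenvector to a `(−ν)`-eigenvector: `√−p` SWAPS the two eigenlines `E^±` of McCallum §3
# (cell `bsd-print-cfram`, seat `bsd-line-cfram-p1-w2` g5; helper `--supports` 20372; 0 facts, 0 defs)

HONEST FRAMING. Nothing about BSD is proved here, and nothing of S2 itself. McCallum's Prop. 3.1
(`…BorelMcCallumProp31`, file 8f) wants eigenvectors `e₊, e₋` of the involutive lift `τ` of complex
conjugation on `W(K̄)[p^M]`; the tree produces them from the Weil pairing
(`RatClosure.exists_eigenvectors`, `IsLiftOfAut.exists_eigenvector_pow`). At the Borel CM-ramified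
prime there is extra structure, recorded here: complex conjugation `c₀ ∈ Γ_ℚ` negates `√−p`
(`smul_sqrt_eq_neg_of_isComplexConjugation`: `ι(c₀ s) = conj(ι s)` and `ι(s)² = −p < 0` forces
`ι(s) ∈ iℝ`), hence anti-commutes with `μ` (`apply_smul_eq_neg_of_isComplexConjugation`, the sign
rule of `exists_sqrt_end_of_cmRamified`); transported to `W(K̄)[n]` along
`θ = RatClosure.torsionEquiv` for a lift `τ = absGaloisTransport c₀`
(`RatClosure.torsionEquiv_smul_of_lift`): **`τ(μ t) = −ν · μ t` whenever `τ t = ν t`**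
(`torsionMap_mu_eq_neg_of_eigen`) — `μ = √−p` maps `E^{ν}` to `E^{−ν}`, killing exactly the rational
line `W[𝔭] = ker μ` (which is one of the two eigenlines at level `p`). So on the class `e₋` may be
taken to be `μ e₊` whenever `e₊ ∉ W[𝔭]` (`exists_eigenvector_neg_of_eigenvector`), and the `±`-parts of
an `𝓞`-module of classes are exchanged by `√−p` — the mechanism behind the pair-sum / isogeny-switch
shape of S2. THEOREMS ONLY; no definition, no named fact, no `sorry`. BSD is not proved by any of
this; no summit statement is proved by this seat.
References: [McCallumLMS1991] §3 (`E_{p^M}^±`); [GrossLMS1991] §9; [Rubin1999] Cor. 5.5;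
[SerreAbelianLadic1968] I §2.2 (complex conjugation in `Γ_ℚ`).
-/

set_option autoImplicit false
-- `…BirchSwinnertonDyer.BirchSwinnertonDyer.Theorems…` is the problem's mandated namespace (D-0017).
set_option linter.dupNamespace false

noncomputable section

open scoped Classical

namespace Summit.BirchSwinnertonDyer.BirchSwinnertonDyer.Theorems.PrintCFram.BorelKolyvaginPairing

open WeierstrassCurve Field Literature.NumberTheory.EllipticCurves
  Literature.NumberTheory.EllipticCurves.KolyvaginPairing Literature.NumberTheory.GaloisRepresentations
  Literature.NumberTheory.EllipticCurves.Rank1Residual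
  Summit.BirchSwinnertonDyer.BirchSwinnertonDyer.Theorems.PrintCFram.BorelHomothety

/-! ## §1 Complex conjugation negates `√−p` and anti-commutes with `μ` -/

section Conj

variable (p : ℕ) [hp : Fact p.Prime]

omit hp in
/-- **`c₀ · √−p = −√−p`** for a complex conjugation `c₀ ∈ Γ_ℚ`: under the embedding `ι : ℚ̄ → ℂ`
with `ι(c₀ x) = conj(ι x)`, `ι(s)² = −p < 0` forces `Re ι(s) = 0`, so `conj ι(s) = −ι(s)`.
[cite: SerreAbelianLadic1968, I §2.2] -/
theorem smul_sqrt_eq_neg_of_isComplexConjugation (hp0 : 0 < p) {c₀ : absoluteGaloisGroup ℚ}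
    (hc₀ : IsComplexConjugation (Rat.castHom ℝ) c₀) {s : AlgebraicClosure ℚ}
    (hs : s ^ 2 = ((-(p : ℤ) : ℤ) : AlgebraicClosure ℚ)) : c₀ • s = -s := by
  obtain ⟨ι, -, hι⟩ := isComplexConjugation_iff.mp hc₀
  set z : ℂ := ι s with hz_def
  have hz : z ^ 2 = -(p : ℂ) := by
    rw [hz_def, ← map_pow, hs]; push_cast; simp
  -- `Re z = 0`
  have hre2 : (z ^ 2).re = -(p : ℝ) := by rw [hz]; simp
  have him2 : (z ^ 2).im = 0 := by rw [hz]; simp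
  rw [pow_two, Complex.mul_re] at hre2
  rw [pow_two, Complex.mul_im] at him2
  have hre : z.re = 0 := by
    by_contra h
    have him : z.im = 0 := by
      have : 2 * (z.re * z.im) = 0 := by linarith
      rcases mul_eq_zero.mp this with h2 | h2
      · norm_num at h2
      · rcases mul_eq_zero.mp h2 with h3 | h3
        · exact absurd h3 h
        · exact h3
    rw [him, mul_zero, sub_zero] at hre2
    have hp' : (0 : ℝ) < p := by exact_mod_cast hp0
    nlinarith [mul_self_nonneg z.re]
  have hconj : starRingEnd ℂ z = -z := by
    apply Complex.ext
    · simp [hre]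
    · simp
  apply ι.injective
  rw [hι, map_neg]
  exact hconj

/-- **Complex conjugation anti-commutes with `μ = √−p`**: `μ(c₀ P) = −c₀ μ(P)` on `W(ℚ̄)` (the sign
rule of `exists_sqrt_end_of_cmRamified`). [cite: Rubin1999, Cor. 5.5] -/
theorem apply_smul_eq_neg_of_isComplexConjugation {W : WeierstrassCurve ℚ} {c₀ : absoluteGaloisGroup ℚ}
    (hc₀ : IsComplexConjugation (Rat.castHom ℝ) c₀) {s : AlgebraicClosure ℚ}
    {μ : AddMonoid.End W.geomPoints} (hs : s ^ 2 = ((-(p : ℤ) : ℤ) : AlgebraicClosure ℚ))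
    (hanti : ∀ g : absoluteGaloisGroup ℚ, g • s = -s → ∀ P, μ (g • P) = -(g • μ P))
    (P : W.geomPoints) : μ (c₀ • P) = -(c₀ • μ P) :=
  hanti c₀ (smul_sqrt_eq_neg_of_isComplexConjugation p hp.out.pos hc₀ hs) P

end Conj

/-! ## §2 On `W(K̄)[n]`: `√−p` swaps the eigenlines of the lift of complex conjugation -/

section Swap

variable (W : WeierstrassCurve ℚ) [W.IsElliptic] (p : ℕ) [hp : Fact p.Prime]
variable {K : Type} [Field K] [NumberField K]
variable {σ : K ≃ₐ[ℚ] K} {τ : AlgebraicClosure K ≃+* AlgebraicClosure K} {c₀ : absoluteGaloisGroup ℚ}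

omit [W.IsElliptic] hp in
/-- `μ` preserves `W[n]`. [folklore] -/
theorem apply_mem_geomTorsion {μ : AddMonoid.End W.geomPoints} {n : ℤ} {P : W.geomPoints}
    (hP : P ∈ W.geomTorsion n) : μ P ∈ W.geomTorsion n := by
  rw [mem_geomTorsion_iff] at hP ⊢
  rw [← map_zsmul, hP, map_zero]

omit [W.IsElliptic] in
/-- **`τ(μ t) = −ν μ t` if `τ t = ν t`.** For the lift `τ = absGaloisTransport c₀` of `σ ∈ Aut(K/ℚ)`
through a complex conjugation `c₀` and `μ = √−p` with its sign rule: on `W(K̄)[n]` (identified with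
`W(ℚ̄)[n]` by `θ = RatClosure.torsionEquiv`) the endomorphism `√−p` sends `ν`-eigenvectors of `τ` to
`(−ν)`-eigenvectors. [cite: McCallumLMS1991, §3 (E^±)] [cite: Rubin1999, Cor. 5.5] -/
theorem torsionMap_mu_eq_neg_of_eigen (hτ : IsLiftOfAut σ τ)
    (hγ : ∀ x, τ x = absGaloisTransport (K := ℚ) (L := K) c₀ x)
    (hc₀ : IsComplexConjugation (Rat.castHom ℝ) c₀) {s : AlgebraicClosure ℚ}
    {μ : AddMonoid.End W.geomPoints} (hs : s ^ 2 = ((-(p : ℤ) : ℤ) : AlgebraicClosure ℚ))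
    (hanti : ∀ g : absoluteGaloisGroup ℚ, g • s = -s → ∀ P, μ (g • P) = -(g • μ P))
    (n : ℤ) {ν : ℤ} (t : geomTorsion (W.baseChange K) n) (ht : hτ.torsionMap W n t = ν • t) :
    hτ.torsionMap W n (RatClosure.torsionEquiv (K := K) W n
        ⟨μ ((RatClosure.torsionEquiv (K := K) W n).symm t : W.geomTorsion n),
          apply_mem_geomTorsion W ((RatClosure.torsionEquiv (K := K) W n).symm t).2⟩) =
      -(ν • RatClosure.torsionEquiv (K := K) W n
        ⟨μ ((RatClosure.torsionEquiv (K := K) W n).symm t : W.geomTorsion n),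
          apply_mem_geomTorsion W ((RatClosure.torsionEquiv (K := K) W n).symm t).2⟩) := by
  set θ := RatClosure.torsionEquiv (K := K) W n with hθ
  set t₀ := θ.symm t with ht₀
  have htt₀ : t = θ t₀ := (θ.apply_symm_apply t).symm
  -- `c₀ • t₀ = ν • t₀` (transport of the eigen-relation)
  have hc₀t₀ : c₀ • t₀ = ν • t₀ := by
    apply θ.injective
    rw [RatClosure.torsionEquiv_smul_of_lift W hτ c₀ hγ n t₀, map_zsmul, ← htt₀, ht]
  -- `τ (θ ⟨μ t₀⟩) = θ (c₀ • ⟨μ t₀⟩) = θ ⟨−ν μ t₀⟩`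
  rw [← RatClosure.torsionEquiv_smul_of_lift W hτ c₀ hγ n, ← map_zsmul, ← map_neg]
  congr 1
  apply Subtype.ext
  change c₀ • μ (t₀ : W.geomPoints) = -(ν • μ (t₀ : W.geomPoints))
  have h := apply_smul_eq_neg_of_isComplexConjugation p hc₀ hs hanti (t₀ : W.geomPoints)
  have hcoe : c₀ • (t₀ : W.geomPoints) = ν • (t₀ : W.geomPoints) := by
    have := congrArg (fun x : W.geomTorsion n => (x : W.geomPoints)) hc₀t₀
    simp only [AddSubgroupClass.coe_zsmul] at this
    exact this
  rw [hcoe, map_zsmul] at h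
  -- `h : ν • μ t₀ = -(c₀ • μ t₀)`
  rw [← neg_neg (c₀ • μ (t₀ : W.geomPoints)), ← h]

omit [W.IsElliptic] in
/-- **`e₋ := √−p · e₊`.** Under the same hypotheses, from a `ν`-eigenvector `t` of `τ` on `W(K̄)[n]`
whose `θ⁻¹`-image is NOT killed by `μ` one gets a non-zero `(−ν)`-eigenvector, namely `θ(μ θ⁻¹ t)`:
on the class both eigen-signs are populated as soon as one eigenvector lies off the line `W[𝔭]`.
[cite: McCallumLMS1991, §3 (E^±)] -/
theorem exists_eigenvector_neg_of_eigenvector (hτ : IsLiftOfAut σ τ)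
    (hγ : ∀ x, τ x = absGaloisTransport (K := ℚ) (L := K) c₀ x)
    (hc₀ : IsComplexConjugation (Rat.castHom ℝ) c₀) {s : AlgebraicClosure ℚ}
    {μ : AddMonoid.End W.geomPoints} (hs : s ^ 2 = ((-(p : ℤ) : ℤ) : AlgebraicClosure ℚ))
    (hanti : ∀ g : absoluteGaloisGroup ℚ, g • s = -s → ∀ P, μ (g • P) = -(g • μ P))
    (n : ℤ) {ν : ℤ} (t : geomTorsion (W.baseChange K) n) (ht : hτ.torsionMap W n t = ν • t)
    (hμt : μ ((RatClosure.torsionEquiv (K := K) W n).symm t : W.geomTorsion n) ≠ 0) :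
    ∃ t' : geomTorsion (W.baseChange K) n, t' ≠ 0 ∧ hτ.torsionMap W n t' = -(ν • t') := by
  refine ⟨_, fun h0 => hμt ?_, torsionMap_mu_eq_neg_of_eigen W p hτ hγ hc₀ hs hanti n t ht⟩
  have h := congrArg (fun x : W.geomTorsion n => (x : W.geomPoints))
    ((RatClosure.torsionEquiv (K := K) W n).map_eq_zero_iff.mp h0)
  simpa using h

end Swap

end Summit.BirchSwinnertonDyer.BirchSwinnertonDyer.Theorems.PrintCFram.BorelKolyvaginPairing

end
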